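import Summits.Ventures.YMGap.Thresholds.SharpClusteringPoissonB
import HarnessLib

/-!
# Venture YMGap — static exponential clustering, Part II-e:
# `H¹`-density of `J(A𝒫)` and approximate solvability of the Poisson equation in `H¹(μ_S)`

HONEST FRAMING: venture file (cell `pub-ymgap`, track (a), seat lit-1). This file closes Part II of
the static (semigroup-free) proof of Shen–Zhu–Zhu's mass-gap step (`shenZhuZhu_massGap_transfer`):
the regularity-free substitute for solving the Poisson equation `L_S u = g - ⟨g⟩_{μ_S}`.
No physics and no number in this file.

* `JAPoly`: the subspace `J(A𝒫) = {J(Aq)} ⊆ H¹ ⊆ 𝓗`, `A = Δ - W` (`schOp`), `J F = (F, ∇F)`.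
* `sobJ_mem_closure_JAPoly`: for smooth `h` with `∫ h e^{S/2} dσ^{⊗E} = 0`, `J h` lies in the closure
  of `J(A𝒫)` — by Part II-d a functional `z ⊥ J(A𝒫)` is, on smooth functions, `m⟨·, e^{S/2}⟩` after
  projecting onto `H¹`.
* `exists_schOp_tendsto`: hence polynomials `q_k` with `∫ (Aq_k - h)² → 0` AND
  `∫ Γ(Aq_k - h, Aq_k - h) → 0`.
* `exists_approx_poisson`: undoing the ground-state transform (`v_k = e^{-S/2} q_k`,
  `L_S v_k = e^{-S/2} A q_k`, seat p2's `genL_groundState`), for every smooth `g` and constant `m` with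
  `∫ e^S (g - m) = 0` there are smooth `v_k` with `∫ e^S (L_S v_k - (g - m))² dσ^{⊗E} → 0` and
  `∫ e^S Γ(L_S v_k - (g - m)) dσ^{⊗E} → 0`: the Poisson equation is solvable up to errors that are
  small in `H¹(μ_S)`, which is what the covariance identity of Part III consumes.

## References

* B. Helffer, J. Funct. Anal. 155 (1998) 571–586; Venture files `LatticeBakryEmeryGroundState.lean`
  (seat p2), `SharpClustering{Sobolev,WeakGrad,PoissonA,PoissonB}.lean` (this seat).
-/

noncomputable section

open scoped Matrix ComplexConjugate BigOperators Matrix.Norms.Frobenius ContDiff Topology InnerProductSpace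
open Matrix Complex Finset MeasureTheory Filter
open Literature.MathematicalPhysics.QuantumFieldTheory

namespace Summit.Ventures.YMGap

namespace SharpClustering

open LatticeBakryEmery

universe u

variable {ι : Type u} [Fintype ι] [DecidableEq ι] {N : ℕ}

/-! ### Linearity of `q ↦ J(Aq)` -/

/-- `J` only depends on the function. -/
theorem sobJ_congr {F G : Cfg ι N → ℝ} (hF : ContDiff ℝ ∞ F) (hG : ContDiff ℝ ∞ G) (h : F = G) :
    sobJ F hF = sobJ G hG := by
  subst h
  rfl

/-- `A(q₁ + q₂) = Aq₁ + Aq₂`. -/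
theorem schOp_add (S : Cfg ι N → ℝ) {q₁ q₂ : Cfg ι N → ℝ} (h₁ : ContDiff ℝ ∞ q₁) (h₂ : ContDiff ℝ ∞ q₂) :
    schOp S (q₁ + q₂) = schOp S q₁ + schOp S q₂ := by
  funext Q
  simp only [schOp, Pi.add_apply, Lap_add h₁ h₂]
  ring

/-- `A(r q) = r Aq`. -/
theorem schOp_smul (S : Cfg ι N → ℝ) (r : ℝ) {q : Cfg ι N → ℝ} (hq : ContDiff ℝ ∞ q) :
    schOp S (r • q) = r • schOp S q := by
  funext Q
  simp only [schOp, Pi.smul_apply, smul_eq_mul, Lap_smul r hq]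
  ring

/-! ### The subspace `J(A𝒫)` -/

/-- The subspace `J(A𝒫) = {J(Aq) : q polynomial} ⊆ 𝓗` (`A = Δ - W`, `W = ¼Γ(S,S) + ½ΔS`). -/
def JAPoly {S : Cfg ι N → ℝ} (hS : ContDiff ℝ ∞ S) : Submodule ℝ (HSp ι N) where
  carrier := {x | ∃ (n : ℕ) (q : Cfg ι N → ℝ) (hq : q ∈ polySpace ι N n),
    x = sobJ (schOp S q) (contDiff_schOp hS (contDiff_of_mem_polySpace hq))}
  add_mem' := by
    rintro x y ⟨n₁, q₁, hq₁, rfl⟩ ⟨n₂, q₂, hq₂, rfl⟩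
    have hq : q₁ + q₂ ∈ polySpace ι N (max n₁ n₂) :=
      Submodule.add_mem _ (polySpace_mono (le_max_left _ _) hq₁) (polySpace_mono (le_max_right _ _) hq₂)
    refine ⟨max n₁ n₂, q₁ + q₂, hq, ?_⟩
    rw [← sobJ_add (contDiff_schOp hS (contDiff_of_mem_polySpace hq₁))
      (contDiff_schOp hS (contDiff_of_mem_polySpace hq₂))]
    exact sobJ_congr _ _ (schOp_add S (contDiff_of_mem_polySpace hq₁) (contDiff_of_mem_polySpace hq₂)).symm
  zero_mem' := by
    have h0 : ContDiff ℝ ∞ (0 : Cfg ι N → ℝ) := contDiff_const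
    refine ⟨0, 0, Submodule.zero_mem _, ?_⟩
    have e : schOp S (0 : Cfg ι N → ℝ) = (0 : ℝ) • schOp S 0 := by
      rw [← schOp_smul S 0 h0, zero_smul]
    have key : ∀ hz : ContDiff ℝ ∞ (schOp S 0), sobJ (schOp S 0) hz = 0 := by
      intro hz
      calc sobJ (schOp S 0) hz
          = sobJ ((0 : ℝ) • schOp S 0) ((contDiff_schOp hS h0).const_smul (0 : ℝ)) := sobJ_congr _ _ e
        _ = (0 : ℝ) • sobJ (schOp S 0) (contDiff_schOp hS h0) := sobJ_smul (0 : ℝ) (contDiff_schOp hS h0)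
        _ = 0 := zero_smul _ _
    exact (key _).symm
  smul_mem' := by
    rintro r x ⟨n, q, hq, rfl⟩
    refine ⟨n, r • q, Submodule.smul_mem _ _ hq, ?_⟩
    rw [← sobJ_smul r (contDiff_schOp hS (contDiff_of_mem_polySpace hq))]
    exact sobJ_congr _ _ (schOp_smul S r (contDiff_of_mem_polySpace hq)).symm

/-- Membership in `J(A𝒫)` of the generators. -/
theorem sobJ_schOp_mem_JAPoly {S : Cfg ι N → ℝ} (hS : ContDiff ℝ ∞ S) {n : ℕ} {q : Cfg ι N → ℝ}
    (hq : q ∈ polySpace ι N n) :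
    sobJ (schOp S q) (contDiff_schOp hS (contDiff_of_mem_polySpace hq)) ∈ JAPoly hS := ⟨n, q, hq, rfl⟩

/-- `J(A𝒫) ⊆ H¹`. -/
theorem JAPoly_le_HOne {dS : ℕ} {S : Cfg ι N → ℝ} (hSp : S ∈ polySpace ι N dS) :
    JAPoly (contDiff_of_mem_polySpace hSp) ≤ HOne ι N := by
  rintro x ⟨n, q, hq, rfl⟩
  exact sobJ_mem_HOne_of_mem_polySpace (schOp_mem_polySpace hSp hq)

/-! ### Density -/

/-- **`H¹`-density of `J(A𝒫)`**: for smooth `h` with `∫ h e^{S/2} dσ^{⊗E} = 0`, `J h` lies in the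
closure of `J(A𝒫)` in `𝓗`. Proof: `closure = ⊥⊥`; a vector `z ⊥ J(A𝒫)` has `H¹`-component
`z₁ ⊥ J(A𝒫)`, which by Part II-d is `m⟨·, e^{S/2}⟩` on smooth functions, so `⟪z, Jh⟫ = ⟪z₁, Jh⟫ =
m ∫ h e^{S/2} = 0`. -/
theorem sobJ_mem_closure_JAPoly (hN : N ≠ 0) {dS : ℕ} {S : Cfg ι N → ℝ} (hSp : S ∈ polySpace ι N dS)
    {h : Cfg ι N → ℝ} (hh : ContDiff ℝ ∞ h)
    (hmean : ∫ g : PSU ι N, h (emb g) * Real.exp (S (emb g) / 2) ∂(haarPi ι N) = 0) :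
    sobJ h hh ∈ (JAPoly (contDiff_of_mem_polySpace hSp)).topologicalClosure := by
  have hS := contDiff_of_mem_polySpace hSp
  rw [← Submodule.orthogonal_orthogonal_eq_closure, Submodule.mem_orthogonal]
  intro z hz
  obtain ⟨z₁, hz₁def⟩ : ∃ z₁ : HSp ι N, z₁ = (HOne ι N).starProjection z := ⟨_, rfl⟩
  have hz₁ : z₁ ∈ HOne ι N := by
    rw [hz₁def]
    simp only [Submodule.starProjection_apply]
    exact Submodule.coe_mem _
  have hz₂ : ∀ y ∈ HOne ι N, ⟪z - z₁, y⟫_ℝ = 0 := fun y hy => by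
    rw [hz₁def]; exact Submodule.starProjection_inner_eq_zero z y hy
  have horth : ∀ (m : ℕ) (q : Cfg ι N → ℝ) (hq : q ∈ polySpace ι N m),
      ⟪sobJ (schOp S q) (contDiff_schOp hS (contDiff_of_mem_polySpace hq)), z₁⟫_ℝ = 0 := by
    intro m q hq
    have ht := sobJ_schOp_mem_JAPoly hS hq
    have h1 : ⟪sobJ (schOp S q) (contDiff_schOp hS (contDiff_of_mem_polySpace hq)), z⟫_ℝ = 0 :=
      Submodule.inner_right_of_mem_orthogonal ht hz
    have h2 := hz₂ _ (JAPoly_le_HOne hSp ht)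
    rw [real_inner_comm] at h2
    have e : z₁ = z - (z - z₁) := by abel
    rw [e, inner_sub_right, h1, h2, sub_zero]
  obtain ⟨m, hm⟩ := inner_sobJ_eq_groundState hN hSp hz₁ horth
  have h3 := hz₂ _ (sobJ_mem_HOne hN hh)
  have e : z = z₁ + (z - z₁) := by abel
  rw [e, inner_add_left, h3, add_zero, real_inner_comm, hm h hh, hmean, mul_zero]

/-- Sequential form with integrals: polynomials `q_k` with `∫ (Aq_k - h)² dσ^{⊗E} → 0` and
`∫ Γ(Aq_k - h, Aq_k - h) dσ^{⊗E} → 0`. -/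
theorem exists_schOp_tendsto (hN : N ≠ 0) {dS : ℕ} {S : Cfg ι N → ℝ} (hSp : S ∈ polySpace ι N dS)
    {h : Cfg ι N → ℝ} (hh : ContDiff ℝ ∞ h)
    (hmean : ∫ g : PSU ι N, h (emb g) * Real.exp (S (emb g) / 2) ∂(haarPi ι N) = 0) :
    ∃ q : ℕ → Cfg ι N → ℝ, (∀ k, ContDiff ℝ ∞ (q k)) ∧
      Tendsto (fun k => ∫ g : PSU ι N, (schOp S (q k) (emb g) - h (emb g)) ^ 2 ∂(haarPi ι N)) atTop (𝓝 0) ∧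
      Tendsto (fun k => ∫ g : PSU ι N, Gam (schOp S (q k) - h) (schOp S (q k) - h) (emb g) ∂(haarPi ι N))
        atTop (𝓝 0) := by
  have hS := contDiff_of_mem_polySpace hSp
  have hmem' : sobJ h hh ∈ closure (JAPoly hS : Set (HSp ι N)) := by
    rw [← Submodule.topologicalClosure_coe]
    exact sobJ_mem_closure_JAPoly hN hSp hh hmean
  obtain ⟨x, hx, hxt⟩ := mem_closure_iff_seq_limit.1 hmem'
  choose n q hq hxq using hx
  have hqc : ∀ k, ContDiff ℝ ∞ (q k) := fun k => contDiff_of_mem_polySpace (hq k)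
  have hsum : Tendsto (fun k => ∫ g : PSU ι N, (schOp S (q k) (emb g) - h (emb g)) ^ 2 ∂(haarPi ι N) +
      ∫ g : PSU ι N, Gam (schOp S (q k) - h) (schOp S (q k) - h) (emb g) ∂(haarPi ι N)) atTop (𝓝 0) := by
    have h1 : Tendsto (fun k => ‖x k - sobJ h hh‖) atTop (𝓝 0) := tendsto_iff_norm_sub_tendsto_zero.1 hxt
    have h2 : Tendsto (fun k => ‖x k - sobJ h hh‖ ^ 2) atTop (𝓝 0) := by simpa using h1.pow 2
    refine h2.congr fun k => ?_
    rw [hxq k, norm_sobJ_sub_sq]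
  have hI₁ : ∀ k, 0 ≤ ∫ g : PSU ι N, (schOp S (q k) (emb g) - h (emb g)) ^ 2 ∂(haarPi ι N) :=
    fun k => integral_nonneg fun g => sq_nonneg _
  have hI₂ : ∀ k, 0 ≤ ∫ g : PSU ι N, Gam (schOp S (q k) - h) (schOp S (q k) - h) (emb g) ∂(haarPi ι N) :=
    fun k => integral_nonneg fun g => Gam_self_nonneg _ _
  refine ⟨q, hqc, ?_, ?_⟩
  · exact tendsto_of_tendsto_of_tendsto_of_le_of_le tendsto_const_nhds hsum hI₁
      fun k => le_add_of_nonneg_right (hI₂ k)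
  · exact tendsto_of_tendsto_of_tendsto_of_le_of_le tendsto_const_nhds hsum hI₂
      fun k => le_add_of_nonneg_left (hI₁ k)

/-! ### Approximate solvability of `L_S u = g - m` in `H¹(e^S σ^{⊗E})` -/

/-- Pointwise bound for the gradient of a ground-state transform:
`e^S Γ(e^{-S/2} r, e^{-S/2} r) ≤ 2 Γ(r,r) + ½ r² Γ(S,S)`. -/
theorem exp_mul_Gam_groundState_le {S r : Cfg ι N → ℝ} (hS : ContDiff ℝ ∞ S) (hr : ContDiff ℝ ∞ r)
    (Q : Cfg ι N) :
    Real.exp (S Q) * Gam (fun Q => Real.exp (-S Q / 2) * r Q) (fun Q => Real.exp (-S Q / 2) * r Q) Q ≤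
      2 * Gam r r Q + (1 / 2) * r Q ^ 2 * Gam S S Q := by
  rw [exp_mul_Gam_groundState hS hr]
  simp only [Gam, mul_sum, ← sum_sub_distrib, ← sum_add_distrib]
  refine sum_le_sum fun a _ => ?_
  nlinarith [sq_nonneg (algD (bframe a) r Q + 1 / 2 * r Q * algD (bframe a) S Q)]

/-- **Approximate solutions of the Poisson equation, `H¹(μ_S)` form.** For a smooth polynomial
potential `S ∈ 𝒫_d`, a smooth `g` and a constant `m` with `∫ e^S (g - m) dσ^{⊗E} = 0` (i.e. `m` is
the `μ_S`-mean of `g`), there are smooth `v_k` with `∫ e^S (L_S v_k - (g - m))² dσ^{⊗E} → 0` and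
`∫ e^S Γ(L_S v_k - (g - m), L_S v_k - (g - m)) dσ^{⊗E} → 0`. -/
theorem exists_approx_poisson (hN : N ≠ 0) {dS : ℕ} {S : Cfg ι N → ℝ} (hSp : S ∈ polySpace ι N dS)
    {g : Cfg ι N → ℝ} (hg : ContDiff ℝ ∞ g) {m : ℝ}
    (hmean : ∫ x : PSU ι N, Real.exp (S (emb x)) * (g (emb x) - m) ∂(haarPi ι N) = 0) :
    ∃ v : ℕ → Cfg ι N → ℝ, (∀ k, ContDiff ℝ ∞ (v k)) ∧
      Tendsto (fun k => ∫ x : PSU ι N, Real.exp (S (emb x)) *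
        (genL S (v k) (emb x) - (g (emb x) - m)) ^ 2 ∂(haarPi ι N)) atTop (𝓝 0) ∧
      Tendsto (fun k => ∫ x : PSU ι N, Real.exp (S (emb x)) *
        Gam (fun Q => genL S (v k) Q - (g Q - m)) (fun Q => genL S (v k) Q - (g Q - m)) (emb x) ∂(haarPi ι N))
        atTop (𝓝 0) := by
  have hS := contDiff_of_mem_polySpace hSp
  have hgm : ContDiff ℝ ∞ (fun Q => g Q - m) := hg.sub contDiff_const
  have hS2 : ContDiff ℝ ∞ (fun Q => S Q / 2) := hS.div_const 2
  obtain ⟨h, hhdef⟩ : ∃ h : Cfg ι N → ℝ, h = fun Q => Real.exp (S Q / 2) * (g Q - m) := ⟨_, rfl⟩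
  have hh : ContDiff ℝ ∞ h := by rw [hhdef]; exact hS2.exp.mul hgm
  have hmean' : ∫ x : PSU ι N, h (emb x) * Real.exp (S (emb x) / 2) ∂(haarPi ι N) = 0 := by
    rw [← hmean]
    refine integral_congr_ae (ae_of_all _ fun x => ?_)
    have e0 : Real.exp (S (emb x) / 2) * Real.exp (S (emb x) / 2) = Real.exp (S (emb x)) := by
      rw [← Real.exp_add, add_halves]
    rw [hhdef]
    linear_combination (g (emb x) - m) * e0
  obtain ⟨q, hqc, h1, h2⟩ := exists_schOp_tendsto hN hSp hh hmean'
  obtain ⟨v, hv⟩ : ∃ v : ℕ → Cfg ι N → ℝ, ∀ k, v k = fun Q => Real.exp (-S Q / 2) * q k Q :=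
    ⟨_, fun _ => rfl⟩
  have hvc : ∀ k, ContDiff ℝ ∞ (v k) := fun k => by rw [hv k]; exact contDiff_groundState hS (hqc k)
  -- `L_S v_k - (g - m) = e^{-S/2} (A q_k - h)`
  have hw : ∀ k Q, genL S (v k) Q - (g Q - m) = Real.exp (-S Q / 2) * (schOp S (q k) - h) Q := by
    intro k Q
    have e0 : Real.exp (-S Q / 2) * Real.exp (S Q / 2) = 1 := by
      rw [← Real.exp_add, show -S Q / 2 + S Q / 2 = 0 by ring, Real.exp_zero]
    rw [hv k, genL_groundState hS (hqc k), hhdef]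
    simp only [Pi.sub_apply, schOp, schW]
    linear_combination (g Q - m) * e0
  have hwf : ∀ k, (fun Q => genL S (v k) Q - (g Q - m)) = fun Q => Real.exp (-S Q / 2) * (schOp S (q k) - h) Q :=
    fun k => funext (hw k)
  have e3 : ∀ Q : Cfg ι N, Real.exp (S Q) * Real.exp (-S Q / 2) ^ 2 = 1 := by
    intro Q
    rw [sq, ← Real.exp_add, ← Real.exp_add, show S Q + (-S Q / 2 + -S Q / 2) = 0 by ring, Real.exp_zero]
  -- sup of `Γ(S,S)` on the compact group
  obtain ⟨CΓ, hCΓ0, hCΓ⟩ := exists_bound_restrict (ι := ι) (contDiff_Gam hS hS)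
  refine ⟨v, hvc, ?_, ?_⟩
  · refine h1.congr fun k => integral_congr_ae (ae_of_all _ fun x => ?_)
    show (schOp S (q k) (emb x) - h (emb x)) ^ 2 = Real.exp (S (emb x)) * (genL S (v k) (emb x) - (g (emb x) - m)) ^ 2
    rw [hw k (emb x), mul_pow, ← mul_assoc, e3, one_mul]
    rfl
  · have hbound : ∀ k, ∫ x : PSU ι N, Real.exp (S (emb x)) *
        Gam (fun Q => genL S (v k) Q - (g Q - m)) (fun Q => genL S (v k) Q - (g Q - m)) (emb x) ∂(haarPi ι N) ≤
        2 * ∫ x : PSU ι N, Gam (schOp S (q k) - h) (schOp S (q k) - h) (emb x) ∂(haarPi ι N) +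
          CΓ / 2 * ∫ x : PSU ι N, (schOp S (q k) (emb x) - h (emb x)) ^ 2 ∂(haarPi ι N) := by
      intro k
      have hrc : ContDiff ℝ ∞ (schOp S (q k) - h) := (contDiff_schOp hS (hqc k)).sub hh
      have i1 : Integrable (fun x : PSU ι N => 2 * Gam (schOp S (q k) - h) (schOp S (q k) - h) (emb x))
          (haarPi ι N) := (integrable_of_continuous_PSU (continuous_restrict (contDiff_Gam hrc hrc)) _).const_mul _
      have i2 : Integrable (fun x : PSU ι N => CΓ / 2 * (schOp S (q k) (emb x) - h (emb x)) ^ 2) (haarPi ι N) :=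
        (integrable_of_continuous_PSU (((continuous_restrict (contDiff_schOp hS (hqc k))).sub
          (continuous_restrict hh)).pow 2) _).const_mul _
      rw [hwf k, ← integral_const_mul, ← integral_const_mul, ← integral_add i1 i2]
      refine integral_mono (integrable_of_continuous_PSU (continuous_restrict
        (hS.exp.mul (contDiff_Gam (contDiff_groundState hS hrc) (contDiff_groundState hS hrc)))) _)
        (i1.add i2) fun x => ?_
      have hb := exp_mul_Gam_groundState_le hS hrc (emb x)
      have hG : Gam S S (emb x) ≤ CΓ := (le_abs_self _).trans (hCΓ x)
      have hr2 : 0 ≤ (schOp S (q k) - h) (emb x) ^ 2 := sq_nonneg _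
      show Real.exp (S (emb x)) * Gam (fun Q => Real.exp (-S Q / 2) * (schOp S (q k) - h) Q)
          (fun Q => Real.exp (-S Q / 2) * (schOp S (q k) - h) Q) (emb x) ≤
        2 * Gam (schOp S (q k) - h) (schOp S (q k) - h) (emb x) + CΓ / 2 * (schOp S (q k) (emb x) - h (emb x)) ^ 2
      have e4 : (schOp S (q k) (emb x) - h (emb x)) ^ 2 = (schOp S (q k) - h) (emb x) ^ 2 := rfl
      rw [e4]
      nlinarith [mul_le_mul_of_nonneg_left hG hr2]
    have hnonneg : ∀ k, 0 ≤ ∫ x : PSU ι N, Real.exp (S (emb x)) *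
        Gam (fun Q => genL S (v k) Q - (g Q - m)) (fun Q => genL S (v k) Q - (g Q - m)) (emb x) ∂(haarPi ι N) :=
      fun k => integral_nonneg fun x => mul_nonneg (Real.exp_pos _).le (Gam_self_nonneg _ _)
    have hlim : Tendsto (fun k => 2 * ∫ x : PSU ι N, Gam (schOp S (q k) - h) (schOp S (q k) - h) (emb x) ∂(haarPi ι N) +
        CΓ / 2 * ∫ x : PSU ι N, (schOp S (q k) (emb x) - h (emb x)) ^ 2 ∂(haarPi ι N)) atTop (𝓝 0) := by
      simpa using (h2.const_mul 2).add (h1.const_mul (CΓ / 2))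
    exact tendsto_of_tendsto_of_tendsto_of_le_of_le tendsto_const_nhds hlim hnonneg hbound

end SharpClustering

end Summit.Ventures.YMGap
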